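import Mathlib.Data.ZMod.Basic
import Literature.NumberTheory.EllipticCurves.Curve21A1Points
import Literature.NumberTheory.EllipticCurves.KleinFrickeLevelSevenTorsion
import Literature.NumberTheory.EllipticCurves.TorsionPointHauptmodul
import Literature.NumberTheory.EllipticCurves.XZeroTwentyOneExplicit
import HarnessLib

/-!
# No elliptic curve over `ℚ` has a rational point of order `21` (Kubert 1976, Ch. IV: the case
# `m = 21` of Mazur's Thm. (7'); the `n = 21` leaf of Mazur's "First reduction")

`Proofs` file (theorems only: **no definition, no named fact, nothing asserted**). It proves the
`n = 21` leaf of the nine Diophantine leaves `n ∈ {14, 15, 16, 18, 21, 25, 27, 35, 49}` that the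
tree's assembly `Literature.NumberTheory.EllipticCurves.Mazur1977_reduction_to_primes_of_leaves`
(`MazurTorsionReductionProofs.lean`) takes as hypotheses towards the named fact
`Mazur1977_reduction_to_primes` (B. Mazur, *Modular curves and the Eisenstein ideal*, Publ.
Math. IHÉS 47 (1977), Ch. III §5, p. 156, "First reduction", after Kubert 1976, Ch. IV:
"`X₁(m)(ℚ)` is cuspidal"), in the literal shape of that hypothesis; the leaf `n = 14` is the
tree's `not_exists_addOrderOf_eq_fourteen` (`KubertFourteenProofs.lean`).

* **`not_exists_addOrderOf_eq_twentyOne`** — no elliptic curve over `ℚ` has a `ℚ`-rational point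
  of order `21`;
* `not_exists_injective_zmod_twentyOne` — equivalently `ℤ/21 ↪̸ E(ℚ)`.

## The proof (`X₁(21)(ℚ)` is cuspidal because its image in `X₀(21)(ℚ)` misses the rational
## `7`-torsion; modular-curve-free)

Let `P ∈ E(ℚ)` have order `21`; then `P₇ = 3P` has order `7` and `P₃ = 7P` has order `3`, both
rational. Over ANY field `K` of characteristic `0` (`exists_hauptmoduln_of_addOrderOf_eq_twentyOne`):
1. Klein–Fricke at `7` from the torsion point `P₇` (the tree's
   `WeierstrassCurve.exists_hauptmodul_seven_of_torsion`, file `KleinFrickeLevelSevenTorsion`,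
   with `L = F = K`): there is `η ∈ K` with `j(E)·η = (η² + 13η + 49)(η² + 5η + 1)³` AND
   `η·d(d − 1) = d³ − 8d² + 5d + 1`, where `d ∈ K` is Tate's `X₁(7)`-parameter of `(E, P₇)`
   (Kubert 1976, Table 3, `N = 7`: `E ≅ E(d³ − d², d² − d)`);
2. the Hauptmodul of `X₀(3)` from `P₃` (`WeierstrassCurve.exists_hauptmodul_three_of_torsion`,
   file `TorsionPointHauptmodul`): `F ∈ K`, `F ≠ 0`, `j(E)·F = (F + 27)(F + 3)³`.
Over `ℚ`:
3. `(F, η)` is a rational point of `X₀(21) = X₀(3) ×_{X(1)} X₀(7)` off the cusps `η ∈ {0, ∞}`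
   (`η ≠ 0` since `j·0 ≠ 49`), hence (`XZeroTwentyOne.exists_point_rat`, the explicit isomorphism
   `X₀(21) ≅ 21a1` of `XZeroTwentyOneExplicit.lean`) a rational point `(x, y)` of
   `21a1 : y² + xy = x³ − 4x − 1` with `η·B(x, y) = 49(xy − 3x − 1)`,
   `B = 9 + 15x + 13y − 2x² − 4xy − x³`;
4. `21a1(ℚ)` is the eight points `O, (−2, 1), (−1, −1), (−1, 2), (−1/4, 1/8), (2, −1), (5, −13),
   (5, 8)` (`Curve21A1.mem_points_of_equation`; Cremona Table 1, `21A1: r = 0, |T| = 8`); at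
   `(−2, 1)` and `(5, −13)` one has `B = 0 ≠ 49(xy − 3x − 1)`, at `(−1, 2)` `η = 0` — the three
   affine cusps — and the four non-cuspidal points give `η ∈ {−49/8, −2, −49/2, −8}` (the curves
   `162b` with a rational `21`-isogeny; `j = −1159088625/2²¹, 3375/2, −189613868625/2⁷,
   −140625/2³`, Kenku's table at level `21`);
5. for these four values the relation `η·d(d − 1) = d³ − 8d² + 5d + 1` is one of the integer cubics
   `8d³ − 15d² − 9d + 8 = 0`, `d³ − 6d² + 3d + 1 = 0`, `2d³ + 33d² − 39d + 2 = 0`,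
   `d³ − 3d + 1 = 0`, none of which has a rational root: each has no root modulo `5` and leading
   coefficient prime to `5` (`rat_cubic_ne_zero_of_zmod`, rational root test read modulo `5`).
So no twist of a curve with a rational `21`-isogeny carries a rational point of order `7`, and
`Y₁(21)(ℚ) = ∅`.

## References

* [Kubert1976] D. S. Kubert, *Universal bounds on the torsion of elliptic curves*, Proc. London
  Math. Soc. (3) 33 (1976) 193–237, Ch. IV (`N = 21`) and Table 3 (`N = 7`).
* [Mazur1977] B. Mazur, *Modular curves and the Eisenstein ideal*, Publ. Math. IHÉS 47 (1977),
  Thm. (7') p. 35; Ch. III §5, First reduction, p. 156.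
* [Ligozat1975] G. Ligozat, *Courbes modulaires de genre 1*, Mém. SMF 43 (1975) (`X₀(21)`).
* [Kenku1982] M. A. Kenku, J. Number Theory 15 (1982) 199–202, proof of Thm. 1 (level `21`).
* [CremonaAlgorithms1997] J. E. Cremona, *Algorithms for Modular Elliptic Curves*, Table 1,
  `N = 21`, curve `A1`.

## Design

Theorems only; `noncomputable section`, `open scoped Classical`. The generic step is stated over a
field `K : Type` of characteristic `0` for the classical `DecidableEq K` instance (the one under
which the tree's Galois-action and Hauptmodul files elaborate the group law; `W.baseChange K = W`
definitionally, `Gal(K/K) = 1`); the statement over `ℚ` carries an ARBITRARY `[DecidableEq ℚ]`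
instance (as Mathlib's group law on `V.toAffine.Point` and the `n = 14` leaf do), reduced to the
classical one by `Subsingleton.elim`. Axioms: `propext`, `Classical.choice`, `Quot.sound`.
-/

noncomputable section

open scoped Classical

namespace Literature.NumberTheory.EllipticCurves

open _root_.WeierstrassCurve

/-! ## §0 Two elementary lemmas -/

/-- **Rational root test, read modulo a prime `p`.** An integer cubic `a d³ + b d² + c d + e`
with `p ∤ a` and no root in `ℤ/pℤ` has no rational root: for `d = n/m` in lowest terms,
`a n³ + b n²m + c nm² + e m³ = 0`; if `p ∣ m` then `p ∣ a n³`, so `p ∣ n`, contradicting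
`gcd(n, m) = 1`; otherwise `n/m mod p` is a root. [folklore] -/
private theorem rat_cubic_ne_zero_of_zmod {p : ℕ} [Fact p.Prime] {a b c e : ℤ} (ha : (a : ZMod p) ≠ 0)
    (hroot : ∀ t : ZMod p, (a : ZMod p) * t ^ 3 + b * t ^ 2 + c * t + e ≠ 0) (d : ℚ) :
    (a : ℚ) * d ^ 3 + b * d ^ 2 + c * d + e ≠ 0 := by
  intro h
  set n : ℤ := d.num with hn
  set m : ℕ := d.den with hm
  have hm0 : (m : ℚ) ≠ 0 := by exact_mod_cast d.den_nz
  have hd : d = n / m := (Rat.num_div_den d).symm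
  have key : ((a * n ^ 3 + b * n ^ 2 * m + c * n * m ^ 2 + e * m ^ 3 : ℤ) : ℚ) = 0 := by
    push_cast
    rw [hd] at h
    field_simp at h
    linear_combination h
  have keyZ : a * n ^ 3 + b * n ^ 2 * m + c * n * m ^ 2 + e * (m : ℤ) ^ 3 = 0 := by
    exact_mod_cast key
  have keyP : (a : ZMod p) * (n : ZMod p) ^ 3 + (b : ZMod p) * (n : ZMod p) ^ 2 * (m : ZMod p) +
      (c : ZMod p) * (n : ZMod p) * (m : ZMod p) ^ 2 + (e : ZMod p) * (m : ZMod p) ^ 3 = 0 := by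
    have hc := congrArg (Int.cast : ℤ → ZMod p) keyZ
    push_cast at hc
    exact hc
  by_cases hmp : (m : ZMod p) = 0
  · -- `p ∣ m`, hence `p ∣ a n³`, `p ∣ n`: contradiction with `gcd(n, m) = 1`
    have h3 : (a : ZMod p) * (n : ZMod p) ^ 3 = 0 := by simpa [hmp] using keyP
    have hn0 : ((n : ZMod p)) = 0 :=
      (pow_eq_zero_iff (n := 3) (by norm_num)).mp ((mul_eq_zero.mp h3).resolve_left ha)
    have hpn : (p : ℤ) ∣ n := (ZMod.intCast_zmod_eq_zero_iff_dvd n p).mp hn0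
    have hpm : (p : ℤ) ∣ (m : ℤ) := Int.natCast_dvd_natCast.mpr ((ZMod.natCast_eq_zero_iff m p).mp hmp)
    have hcop : Int.gcd n m = 1 := by
      rw [hn, hm]
      exact d.reduced
    have hpg : (p : ℤ) ∣ (Int.gcd n m : ℤ) := Int.dvd_coe_gcd hpn hpm
    rw [hcop] at hpg
    have hp1 : p ∣ 1 := by exact_mod_cast hpg
    exact (Fact.out : p.Prime).ne_one (Nat.dvd_one.mp hp1)
  · -- `m` is invertible mod `p`: `n/m` is a root
    apply hroot ((n : ZMod p) / (m : ZMod p))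
    field_simp
    linear_combination keyP

/-- The Galois group of `K` over itself acts trivially on `K`-points: an algebra automorphism of
`K` over `K` is the identity. [folklore] -/
private theorem smul_point_eq_self_of_algEquiv_self {K : Type} [Field K] (V : WeierstrassCurve K)
    (σ : K ≃ₐ[K] K) (P : (V.baseChange K).toAffine.Point) : σ • P = P := by
  have hσ : σ = 1 := AlgEquiv.ext fun x => by simpa using σ.commutes x
  rw [hσ, one_smul]

/-! ## §1 The two Hauptmoduln of a point of order `21` (any field of characteristic `0`) -/

/-- **A rational point of order `21` gives a rational point of `X₀(21)` together with Tate's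
`X₁(7)`-parameter.** For an elliptic curve `V` over a field `K` of characteristic `0` and
`P ∈ V(K)` of order `21`: with `P₇ = 3P` (order `7`) and `P₃ = 7P` (order `3`), Klein–Fricke at
`7` from the torsion point (`exists_hauptmodul_seven_of_torsion`, `L = F = K`) gives `η ∈ K` with
`j·η = (η² + 13η + 49)(η² + 5η + 1)³` and `η·d(d − 1) = d³ − 8d² + 5d + 1` for Tate's parameter
`d` of `(V, P₇)` (Kubert 1976, Table 3, `N = 7`), and the `X₀(3)`-Hauptmodul of `P₃`
(`exists_hauptmodul_three_of_torsion`) gives `F ≠ 0` with `j·F = (F + 27)(F + 3)³`.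
[cite: Kubert1976, Table 3 (N = 7) and Ch. IV (N = 21)] -/
theorem exists_hauptmoduln_of_addOrderOf_eq_twentyOne {K : Type} [Field K] [CharZero K]
    (V : WeierstrassCurve K) [V.IsElliptic] (P : V.toAffine.Point) (hP : addOrderOf P = 21) :
    ∃ η F d : K, V.j * η = (η ^ 2 + 13 * η + 49) * (η ^ 2 + 5 * η + 1) ^ 3 ∧ F ≠ 0 ∧
      V.j * F = (F + 27) * (F + 3) ^ 3 ∧ η * (d * (d - 1)) = d ^ 3 - 8 * d ^ 2 + 5 * d + 1 := by
  -- `P₇ = 3P` has order `7`, `P₃ = 7P` has order `3`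
  have h7 : addOrderOf (3 • P) = 7 := by
    rw [addOrderOf_nsmul' P (by norm_num), hP]; decide
  have h3 : addOrderOf (7 • P) = 3 := by
    rw [addOrderOf_nsmul' P (by norm_num), hP]; decide
  -- the points, seen in `V(K) = (V_K)(K)` (definitionally), are fixed by `Gal(K/K) = 1`
  -- Klein–Fricke at `7` with the value of the Hauptmodul
  obtain ⟨η, d, hjη, hηd⟩ : ∃ η d : K, V.j * η = (η ^ 2 + 13 * η + 49) * (η ^ 2 + 5 * η + 1) ^ 3 ∧
      η * (d * (d - 1)) = d ^ 3 - 8 * d ^ 2 + 5 * d + 1 := by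
    rcases h7P : (3 • P : V.toAffine.Point) with _ | ⟨x₇, y₇, h₇⟩
    · rw [h7P, ← Affine.Point.zero_def, addOrderOf_zero] at h7
      omega
    · rw [h7P] at h7
      have h7' : addOrderOf (Affine.Point.some x₇ y₇ h₇ : (V.baseChange K).toAffine.Point) = 7 := h7
      obtain ⟨η, hjη, hη⟩ := exists_hauptmodul_seven_of_torsion (W := V) (L := K) (F := K) h7'
        (fun σ => by
          rw [smul_point_eq_self_of_algEquiv_self V σ]
          exact AddSubgroup.mem_zmultiples _)
      exact ⟨η, (V.baseChange K).tateSeven x₇ y₇, hjη, by simpa using hη⟩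
  -- the Hauptmodul of `X₀(3)` at `P₃`
  have h3ne : (7 • P : V.toAffine.Point) ≠ 0 := by
    intro h0
    rw [h0, addOrderOf_zero] at h3
    omega
  have h3P : (3 : ℕ) • (7 • P) = 0 := h3 ▸ addOrderOf_nsmul_eq_zero (7 • P)
  have hdouble' : ∀ Q : V.toAffine.Point, (3 : ℕ) • Q = 0 → Q + Q = -Q := fun Q hQ => by
    rw [← sub_eq_zero, sub_neg_eq_add, ← hQ, succ_nsmul, two_nsmul]
  have hdouble : (7 • P : V.toAffine.Point) + 7 • P = -(7 • P) := hdouble' _ h3P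
  obtain ⟨F, hF0, hjF⟩ := exists_hauptmodul_three_of_torsion (W := V) (L := K) (F := K)
    (P := (7 • P : V.toAffine.Point)) h3ne hdouble
    (fun σ => Or.inl (smul_point_eq_self_of_algEquiv_self V σ _))
  exact ⟨η, F, d, hjη, hF0, hjF, hηd⟩

/-! ## §2 Over `ℚ`: the four non-cuspidal points of `X₀(21)` carry no rational `7`-torsion -/

/-- The four integer cubics of the `n = 21` leaf have no rational root (no root modulo `5`,
leading coefficient prime to `5`). [folklore] -/
private theorem kubertTwentyOne_cubics_ne_zero (d : ℚ) :
    8 * d ^ 3 - 15 * d ^ 2 - 9 * d + 8 ≠ 0 ∧ d ^ 3 - 6 * d ^ 2 + 3 * d + 1 ≠ 0 ∧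
      2 * d ^ 3 + 33 * d ^ 2 - 39 * d + 2 ≠ 0 ∧ d ^ 3 - 3 * d + 1 ≠ 0 := by
  -- the four residue computations modulo `5` (done before any `Fact (Nat.Prime 5)` enters the
  -- context, so that `decide` sees closed `ZMod 5`-terms)
  have c₁ : ((8 : ℤ) : ZMod 5) ≠ 0 ∧ ∀ t : ZMod 5, ((8 : ℤ) : ZMod 5) * t ^ 3 +
      ((-15 : ℤ) : ZMod 5) * t ^ 2 + ((-9 : ℤ) : ZMod 5) * t + ((8 : ℤ) : ZMod 5) ≠ 0 := by
    constructor <;> decide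
  have c₂ : ((1 : ℤ) : ZMod 5) ≠ 0 ∧ ∀ t : ZMod 5, ((1 : ℤ) : ZMod 5) * t ^ 3 +
      ((-6 : ℤ) : ZMod 5) * t ^ 2 + ((3 : ℤ) : ZMod 5) * t + ((1 : ℤ) : ZMod 5) ≠ 0 := by
    constructor <;> decide
  have c₃ : ((2 : ℤ) : ZMod 5) ≠ 0 ∧ ∀ t : ZMod 5, ((2 : ℤ) : ZMod 5) * t ^ 3 +
      ((33 : ℤ) : ZMod 5) * t ^ 2 + ((-39 : ℤ) : ZMod 5) * t + ((2 : ℤ) : ZMod 5) ≠ 0 := by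
    constructor <;> decide
  have c₄ : ((1 : ℤ) : ZMod 5) ≠ 0 ∧ ∀ t : ZMod 5, ((1 : ℤ) : ZMod 5) * t ^ 3 +
      ((0 : ℤ) : ZMod 5) * t ^ 2 + ((-3 : ℤ) : ZMod 5) * t + ((1 : ℤ) : ZMod 5) ≠ 0 := by
    constructor <;> decide
  have hp : Fact (Nat.Prime 5) := ⟨by norm_num⟩
  refine ⟨?_, ?_, ?_, ?_⟩
  · have h := @rat_cubic_ne_zero_of_zmod 5 hp 8 (-15) (-9) 8 c₁.1 c₁.2 d
    intro h'; apply h; push_cast; linear_combination h'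
  · have h := @rat_cubic_ne_zero_of_zmod 5 hp 1 (-6) 3 1 c₂.1 c₂.2 d
    intro h'; apply h; push_cast; linear_combination h'
  · have h := @rat_cubic_ne_zero_of_zmod 5 hp 2 33 (-39) 2 c₃.1 c₃.2 d
    intro h'; apply h; push_cast; linear_combination h'
  · have h := @rat_cubic_ne_zero_of_zmod 5 hp 1 0 (-3) 1 c₄.1 c₄.2 d
    intro h'; apply h; push_cast; linear_combination h'

/-- **No rational point of order `21`** (Kubert 1976, Ch. IV, case `N = 21`; the `n = 21` leaf of
Mazur's First reduction, Mazur 1977 Ch. III §5 p. 156): no elliptic curve over `ℚ` has a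
`ℚ`-rational point of order `21`. From `exists_hauptmoduln_of_addOrderOf_eq_twentyOne`, the
explicit isomorphism `X₀(21) ≅ 21a1` (`XZeroTwentyOne.exists_point_rat`), the eight rational
points of `21a1` (`Curve21A1.mem_points_of_equation`) and the four cubics
(`kubertTwentyOne_cubics_ne_zero`), as described in the module docstring. Stated for an
arbitrary `DecidableEq ℚ` instance, as the group law of `V.toAffine.Point` is.
[cite: Kubert1976, Ch. IV (N = 21)] [cite: Mazur1977, Ch. III §5 p. 156 (First reduction)]
[cite: Kenku1982, proof of Thm. 1, p. 200 (level 21)] [cite: Ligozat1975] -/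
theorem not_exists_addOrderOf_eq_twentyOne [inst : DecidableEq ℚ] (V : WeierstrassCurve ℚ)
    [V.IsElliptic] : ¬ ∃ P : V.toAffine.Point, addOrderOf P = 21 := by
  -- reduce to the classical `DecidableEq ℚ` instance (all such instances are equal)
  have hI : inst = fun a b => Classical.propDecidable (a = b) := Subsingleton.elim _ _
  subst hI
  rintro ⟨P, hP⟩
  obtain ⟨η, F, d, hjη, -, hjF, hηd⟩ := exists_hauptmoduln_of_addOrderOf_eq_twentyOne V P hP
  obtain ⟨h8, h1, h2, h1'⟩ := kubertTwentyOne_cubics_ne_zero d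
  -- `η ≠ 0`: `(F, η)` is off the cusps of `X₀(21)`
  have hη0 : η ≠ 0 := by
    rintro rfl
    norm_num at hjη
  -- the point of `21a1`
  obtain ⟨x, y, hxy, hrel⟩ := XZeroTwentyOne.exists_point_rat hη0 hjF hjη
  have hmem := Curve21A1.mem_points_of_equation x y hxy
  simp only [Finset.mem_insert, Finset.mem_singleton, Prod.mk.injEq] at hmem
  rcases hmem with ⟨rfl, rfl⟩ | ⟨rfl, rfl⟩ | ⟨rfl, rfl⟩ | ⟨rfl, rfl⟩ | ⟨rfl, rfl⟩ | ⟨rfl, rfl⟩ |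
    ⟨rfl, rfl⟩
  · -- `(-2, 1)`: a cusp, `B = 0 ≠ N`
    norm_num at hrel
  · -- `(-1, -1)`: `η = -49/8`, cubic `8d³ - 15d² - 9d + 8 = 0`
    have hη : η = -49 / 8 := by
      have : η * (-24) = 147 := by linear_combination hrel
      linear_combination this / (-24)
    subst hη
    exact h8 (by linear_combination (-8) * hηd)
  · -- `(-1, 2)`: a cusp, `η = 0`
    have : η * 27 = 0 := by linear_combination hrel
    exact hη0 (by simpa using this)
  · -- `(-1/4, 1/8)`: `η = -2`, cubic `d³ - 6d² + 3d + 1 = 0`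
    have hη : η = -2 := by
      have : η * (441 / 64) = -441 / 32 := by linear_combination hrel
      linear_combination this * (64 / 441)
    subst hη
    exact h1 (by linear_combination (-1) * hηd)
  · -- `(2, -1)`: `η = -49/2`, cubic `2d³ + 33d² - 39d + 2 = 0`
    have hη : η = -49 / 2 := by
      have : η * 18 = -441 := by linear_combination hrel
      linear_combination this / 18
    subst hη
    exact h2 (by linear_combination (-2) * hηd)
  · -- `(5, -13)`: a cusp, `B = 0 ≠ N`
    norm_num at hrel
  · -- `(5, 8)`: `η = -8`, cubic `d³ - 3d + 1 = 0`
    have hη : η = -8 := by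
      have : η * (-147) = 1176 := by linear_combination hrel
      linear_combination this / (-147)
    subst hη
    exact h1' (by linear_combination (-1) * hηd)

/-- **`ℤ/21ℤ` does not embed in `E(ℚ)`** for an elliptic curve `E/ℚ`: no injective additive
homomorphism `ℤ/21 → V(ℚ)` (the image of `1` would have order `21`).
[cite: Kubert1976, Ch. IV (N = 21)] [cite: Mazur1977, Thm. (8) and Ch. III §5 p. 156] -/
theorem not_exists_injective_zmod_twentyOne [DecidableEq ℚ] (V : WeierstrassCurve ℚ)
    [V.IsElliptic] : ¬ ∃ f : ZMod 21 →+ V.toAffine.Point, Function.Injective f := by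
  rintro ⟨f, hf⟩
  refine not_exists_addOrderOf_eq_twentyOne V ⟨f 1, ?_⟩
  rw [addOrderOf_injective f hf, ZMod.addOrderOf_one]

/-- The leaf in the literal shape of the `n = 21` conjunct of the hypothesis `h` of
`Literature.NumberTheory.EllipticCurves.Mazur1977_reduction_to_primes_of_leaves`
(membership form). [cite: Mazur1977, Ch. III §5 p. 156] -/
theorem mazurFirstReduction_leaf_twentyOne (V : WeierstrassCurve ℚ) [V.IsElliptic] (n : ℕ)
    (hn : n ∈ ({21} : Finset ℕ)) : ¬ ∃ P : V.toAffine.Point, addOrderOf P = n := by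
  rw [Finset.mem_singleton] at hn
  subst hn
  exact not_exists_addOrderOf_eq_twentyOne V

end Literature.NumberTheory.EllipticCurves

end
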